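import Literature.AlgebraicGeometry.Resolution.LogRegularEtalePieces
import Literature.AlgebraicGeometry.Resolution.BlowupResolutionCriterion
import Literature.AlgebraicGeometry.Resolution.LogRegularBlowupCriterion
import Literature.AlgebraicGeometry.Resolution.MarkedIdealsLemmas
import Literature.AlgebraicGeometry.Resolution.StalkIdealLemmas
import Literature.AlgebraicGeometry.Resolution.IdealSheafLemmas
import HarnessLib

/-!
# The descended centre on the affine étale pieces of a log regular scheme
# (ÉTALE KATO programme, block EK-3b)

Topic: `Literature/AlgebraicGeometry/Resolution`. Kato 1994 (10.4) on étale charts / Nizioł 2006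
Cor. 5.7: given affine étale pieces `e_k : V_k → X` of a log regular scheme with étale fs charts
`φ_k : P_{idx k} → Γ(V_k, 𝒪)` by a model family (`LogRegularAtlas.EtalePieces`, EK-3a), ONE run
of the KKMS chart step over the family of all one-chart atlases `V_k` and all two-chart atlases
`V_k ×_X V_{k'}` (`Placements.exists_compatible_regular_charts`, EK-2) produces finite sets
`s_i ⊆ P_i` such that the ideal sheaves `J_k := (φ_k(s_{idx k})) · 𝒪_{V_k}`

* agree on the fibre products: `pr₁^* J_k = pr₂^* J_{k'}` on `V_k ×_X V_{k'}` (a descent datum);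
* have nowhere dense centres (`φ_k(p)` is a non-zero-divisor, Nizioł Lemma 2.4 / Kato (4.1));
* have regular blow-ups: every blowing up of `V_k` along `J_k` has regular source.

This is `EtalePieces.exists_descent_centre`; the assembly (effective descent
`comap_iInf_map_eq_of_descent`, EK-5, and `IsBlowup.isResolution_of_flat_cover`, EK-6) is EK-7.

References: [Kato1994] (10.3)–(10.4); [Niziol2006] Lemma 2.4, Cor. 5.7; [GortzWedhorn2020]
Prop. 13.91.
-/

noncomputable section

open AlgebraicGeometry CategoryTheory CategoryTheory.Limits TopologicalSpace Opposite

namespace Literature.AlgebraicGeometry.Resolution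

universe u

namespace LogRegularAtlas.EtalePieces

variable {X : Scheme.{u}} {M : Model} (E : EtalePieces X M)

/-- Germs of `f^*` of a section: `(f^{*}_{V,W} t)_y = f_y^* (t_{f y})`. [folklore] -/
private theorem germ_appLE_eq'' {Y Y' : Scheme.{u}} (f : Y' ⟶ Y) (V : Y.Opens) (W : Y'.Opens)
    (hle : W ≤ f ⁻¹ᵁ V) (y : Y') (hy : y ∈ W) (t : Γ(Y, V)) :
    (Y'.presheaf.germ W y hy).hom (f.appLE V W hle t) =
      (f.stalkMap y).hom ((Y.presheaf.germ V (f.base y) (hle hy)).hom t) := by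
  rw [Scheme.Hom.germ_stalkMap_apply, Scheme.Hom.appLE, CommRingCat.comp_apply,
    TopCat.Presheaf.germ_res_apply]

/-- The stalk at `w` of the pull-back `f^*(I · 𝒪_Y)` (`Y` affine) is generated by the images of
`I` under `germ_W ∘ f^*_{⊤,W}` for any open `W ∋ w`. [folklore] -/
private theorem stalkIdeal_comap_ofIdealTop {Y Y' : Scheme.{u}} [IsAffine Y] (f : Y' ⟶ Y)
    (I : Ideal Γ(Y, ⊤)) (W : Y'.Opens) (w : Y') (hw : w ∈ W) :
    stalkIdeal ((Scheme.IdealSheafData.ofIdealTop I).comap f) w =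
      (I.map (f.appLE ⊤ W le_top).hom).map (Y'.presheaf.germ W w hw).hom := by
  rw [stalkIdeal_comap_eq_map_stalkMap,
    stalkIdeal_eq_map_germ _ ⟨⊤, isAffineOpen_top Y⟩ (Opens.mem_top _), ideal_ofIdealTop_top,
    Ideal.map_map, Ideal.map_map]
  congr 1
  exact RingHom.ext fun t => (germ_appLE_eq'' f ⊤ W le_top w hw t).symm

/-- The same for the ideal generated by the image of a finite set under a chart:
`(f^*((φ(S)) · 𝒪_Y))_w` is generated by the germs of `(f^* ∘ φ)(S)`. [folklore] -/
private theorem stalkIdeal_comap_ofIdealTop_span {Y Y' : Scheme.{u}} [IsAffine Y] (f : Y' ⟶ Y)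
    {n : ℕ} {P : AddSubmonoid (Fin n → ℤ)} (φ : Multiplicative P →* Γ(Y, ⊤)) (S : Set P)
    (W : Y'.Opens) (w : Y') (hw : w ∈ W) :
    stalkIdeal ((Scheme.IdealSheafData.ofIdealTop
      (Ideal.span ((fun p : P => φ (Multiplicative.ofAdd p)) '' S))).comap f) w =
      (Ideal.span ((fun p : P => ((f.appLE ⊤ W le_top).hom.toMonoidHom.comp φ)
        (Multiplicative.ofAdd p)) '' S)).map (Y'.presheaf.germ W w hw).hom := by
  rw [stalkIdeal_comap_ofIdealTop, Ideal.map_span, Set.image_image]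
  rfl

/-- **The descended centre on the affine étale pieces** (Kato 1994 (10.3)–(10.4) on étale
charts; Nizioł 2006, proof of Cor. 5.7): there are ideal sheaves `J_k` on the pieces `V_k`,
namely `J_k = (φ_k(s_{idx k})) · 𝒪_{V_k}` for the finite sets `s_i ⊆ P_i` of ONE run of the
compatible chart step over all one- and two-chart placement atlases, such that
(1) `pr₁^* J_k = pr₂^* J_{k'}` on every `V_k ×_X V_{k'}`; (2) the centres `V(J_k)` are nowhere
dense; (3) every blowing up of `V_k` along `J_k` has regular source.
[cite: Kato1994, (10.3)–(10.4)] [cite: Niziol2006, Cor. 5.7] -/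
theorem exists_descent_centre :
    ∃ J : ∀ k, (E.V k).IdealSheafData,
      (∀ k k', (J k).comap (pullback.fst (E.e k) (E.e k')) =
        (J k').comap (pullback.snd (E.e k) (E.e k'))) ∧
      (∀ k, Dense ((centreCompl (J k) : (E.V k).Opens) : Set (E.V k))) ∧
      (∀ k {Q : Scheme.{u}} (q : Q ⟶ E.V k), IsBlowup q (J k) → Scheme.IsRegular Q) := by
  classical
  -- ONE run of the chart step over all one- and two-chart atlases
  obtain ⟨s, hsne, hs⟩ := Placements.exists_compatible_regular_charts (M := M)
    (Y := Sum.elim E.V (fun kk : E.κ × E.κ => pullback (E.e kk.1) (E.e kk.2)))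
    (fun a => match a with
      | Sum.inl k => E.single k
      | Sum.inr kk => E.pair kk.1 kk.2)
  choose a₀ ha₀ using hsne
  haveI hN : ∀ k, IsNoetherianRing Γ(E.V k, ⊤) := E.isNoetherianRing
  -- the chart ideals `J_k := (φ_k(s_{idx k})) · 𝒪_{V_k}`
  have hItop : ∀ k, (Scheme.IdealSheafData.ofIdealTop
      (Ideal.span ((fun p : M.P (E.idx k) => E.φ k (Multiplicative.ofAdd p)) ''
        (s (E.idx k) : Set (M.P (E.idx k)))))).ideal ⟨⊤, isAffineOpen_top _⟩ =
      Ideal.span ((fun p : M.P (E.idx k) => E.φ k (Multiplicative.ofAdd p)) ''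
        (s (E.idx k) : Set (M.P (E.idx k)))) :=
    fun k => ideal_ofIdealTop_top _
  refine ⟨fun k => Scheme.IdealSheafData.ofIdealTop
      (Ideal.span ((fun p : M.P (E.idx k) => E.φ k (Multiplicative.ofAdd p)) ''
        (s (E.idx k) : Set (M.P (E.idx k))))),
    fun k k' => ?_, fun k => ?_, fun k Q q hq => ?_⟩
  · -- (1) the descent datum, on stalks at `w ∈ W_t`: output (2) of the chart step for the
    -- two-chart atlas of `V_k ×_X V_{k'}`, charts `(t, false)` and `(t, true)`
    apply ext_of_forall_stalkIdeal_eq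
    intro w
    have hw : w ∈ ⨆ tb, ((E.pair k k').U tb : (pullback (E.e k) (E.e k')).Opens) := by
      rw [(E.pair k k').iSup_eq_top]; trivial
    obtain ⟨⟨t, b⟩, ht⟩ := Opens.mem_iSup.mp hw
    have h2 : (Ideal.span ((fun p : M.P (E.idx k) =>
          (E.pairChart k k' (E.cover k k' t) false) (Multiplicative.ofAdd p)) ''
          (s (E.idx k) : Set (M.P (E.idx k))))).map
          ((pullback (E.e k) (E.e k')).presheaf.germ (E.cover k k' t) w ht).hom =
        (Ideal.span ((fun p : M.P (E.idx k') =>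
          (E.pairChart k k' (E.cover k k' t) true) (Multiplicative.ofAdd p)) ''
          (s (E.idx k') : Set (M.P (E.idx k'))))).map
          ((pullback (E.e k) (E.e k')).presheaf.germ (E.cover k k' t) w ht).hom :=
      (hs (Sum.inr (k, k'))).1 (t, false) (t, true) w ht ht
    rw [stalkIdeal_comap_ofIdealTop_span (pullback.fst (E.e k) (E.e k')) (E.φ k) _
        (E.cover k k' t) w ht,
      stalkIdeal_comap_ofIdealTop_span (pullback.snd (E.e k) (E.e k')) (E.φ k') _
        (E.cover k k' t) w ht]
    exact h2
  · -- (2) nowhere dense centre: `φ_k(a₀)` is a non-zero-divisor in `J_k(V_k)` (Nizioł 2.4)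
    refine dense_centreCompl_of_forall_exists_mem_nonZeroDivisors _ fun v =>
      ⟨⟨⊤, isAffineOpen_top _⟩, trivial, E.φ k (Multiplicative.ofAdd (a₀ (E.idx k))), ?_,
        LogChart.map_mem_nonZeroDivisors_of_forall_isLogRegularAt (M.fg (E.idx k))
          (M.saturated (E.idx k)) (fun 𝔭 _ => E.isLogRegularAt k 𝔭) (a₀ (E.idx k))⟩
    rw [hItop]
    exact Ideal.subset_span ⟨a₀ (E.idx k), ha₀ (E.idx k), rfl⟩
  · -- (3) every blowing up of `V_k` along `J_k` is regular: output (3) of the chart step for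
    -- the one-chart atlas of `V_k` (regular localizations of the chart rings)
    have hreg' : ∀ (a : ↥(s (E.idx k)))
        (𝔓 : Ideal (blowupAlgebra ((Scheme.IdealSheafData.ofIdealTop
          (Ideal.span ((fun p : M.P (E.idx k) => E.φ k (Multiplicative.ofAdd p)) ''
            (s (E.idx k) : Set (M.P (E.idx k)))))).ideal ⟨⊤, isAffineOpen_top _⟩)
          (E.φ k (Multiplicative.ofAdd (a : M.P (E.idx k))))))
          [𝔓.IsPrime], IsRegularLocalRing (Localization.AtPrime 𝔓) := by
      rw [hItop]
      intro a 𝔓 h𝔓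
      have h3 := (hs (Sum.inl k)).2 () (a : M.P (E.idx k)) a.2
      exact @h3 𝔓 h𝔓
    refine hq.isRegular_of_blowupAlgebra_cover (fun _ : Unit => ⟨⊤, isAffineOpen_top _⟩)
      (by simp) (hN := fun _ => hN k) (κ := fun _ => ↥(s (E.idx k)))
      (fun _ a => E.φ k (Multiplicative.ofAdd (a : M.P (E.idx k)))) (fun _ a => ?_) (fun _ => ?_)
      (fun _ => hreg')
    · rw [hItop]
      exact Ideal.subset_span ⟨a, a.2, rfl⟩
    · rw [hItop]
      refine Ideal.span_le.2 ?_
      rintro _ ⟨p, hp, rfl⟩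
      exact Ideal.subset_span ⟨⟨p, hp⟩, rfl⟩

end LogRegularAtlas.EtalePieces

end Literature.AlgebraicGeometry.Resolution

end
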